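import Literature.Analysis.FluidPDE.DissipationAnomaly
import Literature.Analysis.FluidPDE.DuchonRobertShellLaw
import HarnessLib

/-!
# Eyink's local 4/5 law: the statements as printed (Eyink 2003, Thm. 1 and Cor. 1)

Topic: Analysis/FluidPDE, companion to `Literature.Analysis.FluidPDE.DissipationAnomaly`
(trunk FluidKinetic, item F13 `DissipationAnomaly`), with the Fubini/polar-coordinates machinery
of `Literature.Analysis.FluidPDE.DuchonRobertShellLaw`.

## Why this file exists (a discrepancy record)

Three accepted declarations vendor the local 4/5 (and 4/3) law **unconditionally**:
`Torus.HasDuchonRobertDefect.hasFourFifthsLaw` and `Torus.HasDuchonRobertDefect.hasFourThirdsLaw`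
(`DissipationAnomaly`) and `Turb.eyink_local_four_fifths` (`Literature.Analysis.FluidPDE.DuchonRobert`,
`HasFourFifthsLaw ∧ HasFourThirdsLaw`): for *every* weak Euler solution `u ∈ L³((0,T) × T^d)` with
Duchon–Robert defect `D`, the distributional limit `lim_{ℓ → 0⁺} ℓ⁻¹ ⨍ (δ_L u(ℓω))³ dω`
**exists** and equals `−C_d D`. The cited source does not prove this. Eyink (Nonlinearity 16
(2003) 137–145 = arXiv:nlin/0208004), §2, proves:

* **Theorem 1.** For `u ∈ L³([0,T] × T³)` a weak solution of incompressible Euler on `T³` and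
  `φ` a *spherically symmetric* mollifier (`C^∞`, compact support, nonnegative, unit integral),
  `φ^ε(ℓ) = ε⁻³ φ(ℓ/ε)`, `δu_L = (ℓ̂ ⊗ ℓ̂) δu`, `δu_T = (1 − ℓ̂ ⊗ ℓ̂) δu`, the two functions
  `D_L^ε(u) = ¾ ∫ d³ℓ {∇φ^ε(ℓ)·δu(ℓ) |δu_L(ℓ)|² + (2/ℓ) φ^ε(ℓ) δu_L(ℓ) |δu_T(ℓ)|²}`,
  `D_T^ε(u) = ⅜ ∫ d³ℓ {∇φ^ε(ℓ)·δu(ℓ) |δu_T(ℓ)|² − (2/ℓ) φ^ε(ℓ) δu_L(ℓ) |δu_T(ℓ)|²}`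
  *both converge in the sense of distributions, as `ε → 0`, to `D(u)`*, the defect distribution
  of the local energy balance `∂ₜ(½|u|²) + ∇·[(½|u|² + p)u] = −D(u)` (Duchon–Robert 2000, Prop. 2).
* **Corollary 1.** *Assume* that the functions `S_L(u,ℓ) = ℓ⁻¹ ∫_{S²} dω(ℓ̂) (δu_L(ℓ))³` and
  `S_T(u,ℓ) = ℓ⁻¹ ∫_{S²} dω(ℓ̂) δu_L(ℓ) |δu_T(ℓ)|²` (`ω` the *unit* Haar measure on `S²`, i.e. a
  spherical average) have limits `S_X(u) = 𝒟-lim_{ℓ → 0} S_X(u,ℓ)`, `X = L, T`. *Then*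
  `S_L(u) = −(4/5) D(u)` and `S_T(u) = −(8/15) D(u)`.

So the existence of the shell limits is a **hypothesis** of Cor. 1, not a conclusion (op. cit.
§3: "Although we have proved a rigorous theorem, it is only established under various
hypotheses"); what is proved unconditionally is the *mollified* law, Thm. 1. The same caveat
applies to the Duchon–Robert 4/3 law, which Eyink 2003, §1 restates as: "*Assuming that the
following limit exists*, `S(u) := 𝒟-lim_{ℓ → 0} S(u,ℓ)` [with
`S(u,ℓ) = ℓ⁻¹ ∫_{S²} dω δu_L(ℓ) |δu(ℓ)|²`], Duchon and Robert [DR00, §5] show that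
`S(u) = −(4/3) D(u)`".

This file states the printed results under **new names**, leaving the three older declarations
untouched (their meaning is not edited in place). Only Theorem 1 remains an unproved named fact;
the 4/3 law and Corollary 1 are theorems (the latter with Theorem 1 threaded as a hypothesis):

* `Torus.longitudinalIncrement u ξ x = ξ̂ · δu(x; ξ)` and
  `Torus.transverseIncrement u ξ x = δu − (ξ̂ · δu) ξ̂`, `ξ̂ = ξ/|ξ|` (Eyink 2003, Thm. 1);
* `Torus.mixedFluxSphereAvg u ℓ x = ⨍_{S^{d-1}} (δu(x; ℓω)·ω) |δu − (δu·ω)ω|² dω`, the sphere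
  average inside `S_T(u,ℓ)` (Eyink 2003, Cor. 1), next to the accepted
  `Torus.longitudinalFluxSphereAvg` (inside `S_L`) and `Torus.energyFluxSphereAvg` (inside `S`);
* `Torus.eyinkLongitudinalApprox φ ε u x = D_L^ε(u)(x)` and
  `Torus.eyinkTransverseApprox φ ε u x = D_T^ε(u)(x)` (Eyink 2003, Thm. 1), for a velocity slice
  `u : T^d → ℝ^d`, with the prefactors `Torus.eyinkLongitudinalConst d = d/4` and
  `Torus.eyinkTransverseConst d = d/(4(d−1))` (`= 3/4` and `3/8` for `d = 3`, the printed values;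
  see the design notes);
* the **named fact** `Torus.HasDuchonRobertDefect.eyinkApprox_tendsto` (Thm. 1, `d = 3`, as
  printed);
* the **theorems** (in `d = 3`, as printed): `Torus.HasDuchonRobertDefect.fourThirdsLaw_of_limit`
  (the conditional 4/3 law, Eyink 2003, §1 after Duchon–Robert 2000, §5 — the `d = 3` case of
  `Torus.HasDuchonRobertDefect.eq_of_tendsto_energyFlux` of `DuchonRobertShellLaw`, where it is
  proved in every dimension and without the Euler equation) and
  `Torus.HasDuchonRobertDefect.fourFifthsLaw_of_limits` (Cor. 1 with its constants `−4/5`,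
  `−8/15`, proved from the hypothesis `hThm : eyinkApprox_tendsto`, i.e. from Thm. 1, as in the
  source), with the glue `hasFourThirdsLaw_of_limit : … → HasFourThirdsLaw T u D`,
  `hasFourFifthsLaw_of_limits : … → HasFourFifthsLaw T u D`, `tendsto_mixedFlux_of_limits` (the
  8/15 law) and the converse remark `Torus.HasFourFifthsLaw.eq_of_tendsto`;
* the general-dimension engine behind Cor. 1 (`d ≥ 2`): `Torus.eyink_integrands_eq_kernel`
  (Eyink's integrands in kernel form: `∇φ^ε·δu (δu_L)² = k_ε(|ξ|) ⟪δu,ξ̂⟫³`,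
  `(2/|ξ|)φ^ε δu_L|δu_T|² = m_ε(|ξ|) ⟪δu,ξ̂⟫ |δu_T|²`, `k_ε(r) = ε^{-d}ε⁻¹Φ'(r/ε)`,
  `m_ε(r) = 2 r⁻¹ ε^{-d} Φ(r/ε)` for the profile `Φ` of `φ`), `Torus.integral_eyinkApprox_eq`
  (for `ε > 0`: `∫∫ D_L^ε ψ = (d/4)|S^{d-1}| [∫ x^dΦ'(x) G_L(εx) + ∫ 2x^{d-1}Φ(x) G_T(εx)]`,
  `∫∫ D_T^ε ψ = (d/(4(d−1)))|S^{d-1}| [∫ x^dΦ' G_T(εx) − ∫ 2x^{d-1}Φ G_T(εx)]`, by Fubini and polar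
  coordinates, `Torus.integral_kernel_increment_eq_polar`; the `1/|ξ|` kernel is integrable for
  `d ≥ 2`, `Torus.integrable_inv_norm_mul_radial`) and `Torus.eq_of_tendsto_eyinkApprox`
  (dominated convergence, `∫ x^dΦ' = −d∫x^{d-1}Φ`, `|S^{d-1}|∫x^{d-1}Φ = 1`, and the linear system
  `(4/d) D = −d S_L + 2 S_T`, `(4(d−1)/d) D = −(d+2) S_T` — in `d = 3` the system of the
  printed proof of Cor. 1, `4/3 D = −3 S_L + 2 S_T`, `8/3 D = −5 S_T` — whence `S_L = −(12/(d(d+2))) D`,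
  `S_T = −(4(d−1)/(d(d+2))) D`).

## Design notes

* Conventions follow `DissipationAnomaly`: separation vectors `ξ ∈ ℝ^d` act on `T^d` through the
  covering map (`Torus.increment`), all `ξ`-integrals are Bochner integrals over `ℝ^d` against
  Lebesgue measure (Eyink integrates over `T³` with `φ ∈ C₀^∞(T³)`; for `ε` small the support of
  `φ^ε` lies in a fundamental domain and the two agree), sphere averages are Mathlib's
  `⨍ … ∂(volume.toSphere)` (`Torus.sphereAvg`), test functions are `Torus.IsSpaceTimeTestIoo T ψ`
  (smooth, compactly supported in `(0,T) × T^d`), and limits `ε, ℓ → 0⁺` are `Tendsto … (𝓝[>] 0)`.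
  As in `HasDuchonRobertDefect.hasFourFifthsLaw`, the `L³` hypothesis is
  `∫⁻₍₀,T₎ ∫⁻ ‖u‖ₑ³ < ∞` and joint measurability is part of `Torus.IsWeakEulerSolutionOn` (it is
  the only field of the Euler class used by the 4/3 law and by Cor. 1-from-Thm. 1).
* `ξ̂ = ‖ξ‖⁻¹ • ξ` has the junk value `0` at `ξ = 0` (a Lebesgue-null set; there
  `longitudinalIncrement = 0`, `transverseIncrement = 0` anyway since `δu(x; 0) = 0`). The term
  `(2/|ξ|) φ^ε(ξ)` is locally integrable for `d ≥ 2`.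
* Prefactors. Eyink prints `¾` and `⅜` in `d = 3`. They are the normalisations making
  `D_X^ε(u) → D(u)`: the mollified longitudinal/transverse velocities converge to `u/3` and `2u/3`
  (op. cit., proof of Thm. 1, "`u_L^ε → ⅓ u` and `u_T^ε → ⅔ u` strong in `L³`", from
  `∫ φ^ε(ℓ) ℓ̂ ⊗ ℓ̂ d³ℓ = ⅓ 1`). In dimension `d` the same identity reads `∫ φ ℓ̂ ⊗ ℓ̂ = d⁻¹ 1`,
  whence the general-`d` prefactors `d/4` and `d/(4(d−1))` recorded here (junk `d/0 = 0` for
  `d = 1`, where `δu_T ≡ 0`); only their `d = 3` values enter the named fact, which is stated in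
  dimension three. This mirrors the accepted general-`d` constants `Torus.fourFifthsConst d`,
  `Torus.fourThirdsConst d` of `DissipationAnomaly`; the general-`d` theorem
  `eq_of_tendsto_eyinkApprox` confirms that with these prefactors the shell limits are
  `−fourFifthsConst d · D` and `−(4(d−1)/(d(d+2))) D`.
* The named fact keeps the Duchon–Robert defect as the hypothesis `Torus.HasDuchonRobertDefect T u D`
  (the `𝒟'`-limit characterisation (1.2) of Eyink 2003, which for `L³` weak Euler solutions is
  Duchon–Robert's Prop. 2), exactly as the older facts do, so that `D` is "the" defect `D(u)`.
* Pointwise algebra: `ξ̂ ⟂ δu_T` and Pythagoras `|δu|² = (δu_L)² + |δu_T|²` for `ξ ≠ 0`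
  (`Torus.norm_sq_increment_eq`), whence the integrands of `(4/d) D_L^ε + (4(d−1)/d) D_T^ε` add
  up to Duchon–Robert's `∇φ^ε · δu |δu|²` (`Torus.eyink_integrand_add`; Eyink 2003, §2:
  `u_L^ε + u_T^ε = u^ε`).

## References

* G. L. Eyink, *Local 4/5-law and energy dissipation anomaly in turbulence*, Nonlinearity 16
  (2003) 137–145, doi:10.1088/0951-7715/16/1/309, arXiv:nlin/0208004 — §1 (1.5)–(1.7), §2 Thm. 1,
  Cor. 1 and its proof, §3. [Eyink2003]
* J. Duchon, R. Robert, *Inertial energy dissipation for weak solutions of incompressible Euler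
  and Navier–Stokes equations*, Nonlinearity 13 (2000) 249–255, Prop. 2, §5. [DuchonRobert2000]
-/

noncomputable section

open MeasureTheory MeasureTheory.Measure TopologicalSpace Set Function Filter Topology Metric Module
open scoped InnerProductSpace RealInnerProductSpace ENNReal NNReal

namespace Literature.Analysis.FluidPDE.Torus

variable {d : Type*} [Fintype d]

/-! ## Longitudinal and transverse increments -/

/-- The **longitudinal increment** `δu_L(x; ξ) = ξ̂ · δu(x; ξ)`, `ξ̂ = ξ/|ξ|`, of a velocity slice
`u : T^d → ℝ^d` (Eyink 2003, Thm. 1: `δu_L = (ℓ̂ ⊗ ℓ̂) δu`, whose length is `|ℓ̂ · δu|`; Cor. 1: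
"`δu_L = ℓ̂ · δu` is the longitudinal velocity increment"). Junk `0` at `ξ = 0` (`ξ̂ := ‖ξ‖⁻¹ • ξ = 0`
there, and `δu(x; 0) = 0` anyway). [cite: Eyink2003, §2 Thm. 1] -/
def longitudinalIncrement (u : UnitAddTorus d → EuclideanSpace ℝ d) (ξ : EuclideanSpace ℝ d)
    (x : UnitAddTorus d) : ℝ :=
  ⟪increment u ξ x, ‖ξ‖⁻¹ • ξ⟫

/-- The **transverse increment** `δu_T(x; ξ) = (1 − ξ̂ ⊗ ξ̂) δu(x; ξ) = δu − (ξ̂ · δu) ξ̂`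
(Eyink 2003, Thm. 1). Junk: at `ξ = 0` it is `δu(x; 0) = 0`. [cite: Eyink2003, §2 Thm. 1] -/
def transverseIncrement (u : UnitAddTorus d → EuclideanSpace ℝ d) (ξ : EuclideanSpace ℝ d)
    (x : UnitAddTorus d) : EuclideanSpace ℝ d :=
  increment u ξ x - longitudinalIncrement u ξ x • ‖ξ‖⁻¹ • ξ

/-- Unfolding the longitudinal increment. [folklore] -/
theorem longitudinalIncrement_apply (u : UnitAddTorus d → EuclideanSpace ℝ d)
    (ξ : EuclideanSpace ℝ d) (x : UnitAddTorus d) :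
    longitudinalIncrement u ξ x = ⟪increment u ξ x, ‖ξ‖⁻¹ • ξ⟫ :=
  rfl

/-- Unfolding the transverse increment. [folklore] -/
theorem transverseIncrement_apply (u : UnitAddTorus d → EuclideanSpace ℝ d)
    (ξ : EuclideanSpace ℝ d) (x : UnitAddTorus d) :
    transverseIncrement u ξ x = increment u ξ x - longitudinalIncrement u ξ x • ‖ξ‖⁻¹ • ξ :=
  rfl

/-- At zero separation the longitudinal increment vanishes. [folklore] -/
@[simp]
theorem longitudinalIncrement_zero (u : UnitAddTorus d → EuclideanSpace ℝ d) (x : UnitAddTorus d) :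
    longitudinalIncrement u 0 x = 0 := by
  simp [longitudinalIncrement]

/-- At zero separation the transverse increment vanishes. [folklore] -/
@[simp]
theorem transverseIncrement_zero (u : UnitAddTorus d → EuclideanSpace ℝ d) (x : UnitAddTorus d) :
    transverseIncrement u 0 x = 0 := by
  simp [transverseIncrement]

/-- The unit vector `ξ̂ = ‖ξ‖⁻¹ • ξ` has norm one for `ξ ≠ 0`. [folklore] -/
theorem norm_inv_norm_smul {ξ : EuclideanSpace ℝ d} (hξ : ξ ≠ 0) : ‖‖ξ‖⁻¹ • ξ‖ = 1 := by
  rw [norm_smul, norm_inv, norm_norm, inv_mul_cancel₀ (norm_ne_zero_iff.2 hξ)]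

/-- **The transverse increment is orthogonal to the separation direction**: `ξ̂ · δu_T = 0` for
`ξ ≠ 0` (Eyink 2003, Thm. 1: `δu_T = (1 − ℓ̂ ⊗ ℓ̂) δu` is a projection onto `ℓ̂^⊥`). [cite: Eyink2003, §2 Thm. 1] -/
theorem inner_transverseIncrement_unit {u : UnitAddTorus d → EuclideanSpace ℝ d}
    {ξ : EuclideanSpace ℝ d} (hξ : ξ ≠ 0) (x : UnitAddTorus d) :
    ⟪transverseIncrement u ξ x, ‖ξ‖⁻¹ • ξ⟫ = 0 := by
  have h1 : ⟪‖ξ‖⁻¹ • ξ, ‖ξ‖⁻¹ • ξ⟫ = (1 : ℝ) := by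
    rw [real_inner_self_eq_norm_sq, norm_inv_norm_smul hξ, one_pow]
  rw [transverseIncrement, inner_sub_left, inner_smul_left, h1, longitudinalIncrement]
  simp

/-- **Pythagoras for increments**: `|δu|² = (δu_L)² + |δu_T|²` for `ξ ≠ 0` (Eyink 2003, proof of
Thm. 1: `u_L + u_T = u` with `u_L ⟂ u_T`; used in Cor. 1 to split `|δu|²`). [cite: Eyink2003, §2 Thm. 1] -/
theorem norm_sq_increment_eq {u : UnitAddTorus d → EuclideanSpace ℝ d} {ξ : EuclideanSpace ℝ d}
    (hξ : ξ ≠ 0) (x : UnitAddTorus d) :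
    ‖increment u ξ x‖ ^ 2 = longitudinalIncrement u ξ x ^ 2 + ‖transverseIncrement u ξ x‖ ^ 2 := by
  have hdecomp : increment u ξ x =
      longitudinalIncrement u ξ x • ‖ξ‖⁻¹ • ξ + transverseIncrement u ξ x := by
    rw [transverseIncrement, add_sub_cancel]
  have horth : ⟪longitudinalIncrement u ξ x • ‖ξ‖⁻¹ • ξ, transverseIncrement u ξ x⟫ = (0 : ℝ) := by
    rw [inner_smul_left, real_inner_comm, inner_transverseIncrement_unit hξ]
    simp
  have hnorm : ‖longitudinalIncrement u ξ x • ‖ξ‖⁻¹ • ξ‖ = |longitudinalIncrement u ξ x| := by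
    rw [norm_smul, norm_inv_norm_smul hξ, mul_one, Real.norm_eq_abs]
  conv_lhs => rw [hdecomp]
  rw [norm_add_sq_real, horth, hnorm, mul_zero, add_zero, sq_abs]

/-! ## The sphere average inside `S_T` -/

/-- The **sphere-averaged mixed (longitudinal × transverse²) flux** at scale `ℓ` and point `x`:
`⨍_{S^{d-1}} (δu(x; ℓω) · ω) |δu(x; ℓω) − (δu(x; ℓω) · ω) ω|² dω`, i.e. `⟨δu_L |δu_T|²⟩_{ang}`, the
sphere average inside Eyink's `S_T(u,ℓ) = ℓ⁻¹ ∫_{S²} dω δu_L(ℓ) |δu_T(ℓ)|²` (Eyink 2003, Cor. 1;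
the factor `ℓ⁻¹` is applied by the consumer, as for the accepted `longitudinalFluxSphereAvg`).
Mathlib's average `⨍` over `volume.toSphere` (junk `0` for empty `d`). [cite: Eyink2003, §2 Cor. 1] -/
def mixedFluxSphereAvg (u : UnitAddTorus d → EuclideanSpace ℝ d) (ℓ : ℝ) (x : UnitAddTorus d) : ℝ :=
  sphereAvg fun ω =>
    ⟪increment u (ℓ • ω) x, ω⟫ * ‖increment u (ℓ • ω) x - ⟪increment u (ℓ • ω) x, ω⟫ • ω‖ ^ 2

/-- Unfolding `mixedFluxSphereAvg`. [folklore] -/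
theorem mixedFluxSphereAvg_def (u : UnitAddTorus d → EuclideanSpace ℝ d) (ℓ : ℝ) (x : UnitAddTorus d) :
    mixedFluxSphereAvg u ℓ x = sphereAvg fun ω =>
      ⟪increment u (ℓ • ω) x, ω⟫ * ‖increment u (ℓ • ω) x - ⟪increment u (ℓ • ω) x, ω⟫ • ω‖ ^ 2 :=
  rfl

/-- At scale `ℓ = 0` the mixed flux vanishes (all increments are zero). [folklore] -/
@[simp]
theorem mixedFluxSphereAvg_zero (u : UnitAddTorus d → EuclideanSpace ℝ d) (x : UnitAddTorus d) :
    mixedFluxSphereAvg u 0 x = 0 := by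
  simp [mixedFluxSphereAvg, sphereAvg]

/-! ## Eyink's mollified fluxes `D_L^ε(u)`, `D_T^ε(u)` -/

variable (d) in
/-- The prefactor `d/4` of `D_L^ε(u)` (`= ¾` for `d = 3`, the printed value, Eyink 2003, Thm. 1;
in dimension `d` it is the normalisation `u_L^ε → u/d`, see the module docstring).
Junk `card d / 4` is harmless for empty `d`. [cite: Eyink2003, §2 Thm. 1] -/
def eyinkLongitudinalConst : ℝ :=
  (Fintype.card d : ℝ) / 4

variable (d) in
/-- The prefactor `d/(4(d−1))` of `D_T^ε(u)` (`= ⅜` for `d = 3`, the printed value, Eyink 2003,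
Thm. 1; in dimension `d` it is the normalisation `u_T^ε → (d−1)u/d`). Junk `d/0 = 0` for `d ≤ 1`. [cite: Eyink2003, §2 Thm. 1] -/
def eyinkTransverseConst : ℝ :=
  (Fintype.card d : ℝ) / (4 * ((Fintype.card d : ℝ) - 1))

/-- `eyinkLongitudinalConst (Fin 3) = 3/4` (Eyink 2003, Thm. 1). [cite: Eyink2003, §2 Thm. 1] -/
theorem eyinkLongitudinalConst_fin_three : eyinkLongitudinalConst (Fin 3) = 3 / 4 := by
  norm_num [eyinkLongitudinalConst]

/-- `eyinkTransverseConst (Fin 3) = 3/8` (Eyink 2003, Thm. 1). [cite: Eyink2003, §2 Thm. 1] -/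
theorem eyinkTransverseConst_fin_three : eyinkTransverseConst (Fin 3) = 3 / 8 := by
  norm_num [eyinkTransverseConst]

/-- The integrand of `D_L^ε(u)(x)` at separation `ξ`:
`∇φ^ε(ξ) · δu (δu_L)² + (2/|ξ|) φ^ε(ξ) δu_L |δu_T|²` (Eyink 2003, Thm. 1), for a mollifier `φ`
(`Fluid.mollifierScale ε φ = φ^ε`, gradient = Mathlib's `gradient` on `ℝ^d`). [cite: Eyink2003, §2 Thm. 1] -/
def eyinkLongitudinalIntegrand (φ : EuclideanSpace ℝ d → ℝ) (ε : ℝ)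
    (u : UnitAddTorus d → EuclideanSpace ℝ d) (x : UnitAddTorus d) (ξ : EuclideanSpace ℝ d) : ℝ :=
  ⟪_root_.gradient (FluidPDE.mollifierScale ε φ) ξ, increment u ξ x⟫ * longitudinalIncrement u ξ x ^ 2 +
    2 * ‖ξ‖⁻¹ * FluidPDE.mollifierScale ε φ ξ * longitudinalIncrement u ξ x *
      ‖transverseIncrement u ξ x‖ ^ 2

/-- The integrand of `D_T^ε(u)(x)` at separation `ξ`:
`∇φ^ε(ξ) · δu |δu_T|² − (2/|ξ|) φ^ε(ξ) δu_L |δu_T|²` (Eyink 2003, Thm. 1). [cite: Eyink2003, §2 Thm. 1] -/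
def eyinkTransverseIntegrand (φ : EuclideanSpace ℝ d → ℝ) (ε : ℝ)
    (u : UnitAddTorus d → EuclideanSpace ℝ d) (x : UnitAddTorus d) (ξ : EuclideanSpace ℝ d) : ℝ :=
  ⟪_root_.gradient (FluidPDE.mollifierScale ε φ) ξ, increment u ξ x⟫ * ‖transverseIncrement u ξ x‖ ^ 2 -
    2 * ‖ξ‖⁻¹ * FluidPDE.mollifierScale ε φ ξ * longitudinalIncrement u ξ x *
      ‖transverseIncrement u ξ x‖ ^ 2

/-- **Eyink's mollified longitudinal flux**
`D_L^ε(u)(x) = (d/4) ∫_{ℝ^d} {∇φ^ε(ξ) · δu(x;ξ) (δu_L)² + (2/|ξ|) φ^ε(ξ) δu_L |δu_T|²} dξ`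
(Eyink 2003, Thm. 1, with `¾` in `d = 3`), for a velocity slice `u : T^d → ℝ^d`. Bochner integral
in `ξ` (junk `0` off integrability; for `u ∈ L³` and `ψ`-pairings it is the honest integral,
`|ξ|⁻¹` being locally integrable for `d ≥ 2`). [cite: Eyink2003, §2 Thm. 1] -/
def eyinkLongitudinalApprox (φ : EuclideanSpace ℝ d → ℝ) (ε : ℝ)
    (u : UnitAddTorus d → EuclideanSpace ℝ d) (x : UnitAddTorus d) : ℝ :=
  eyinkLongitudinalConst d * ∫ ξ, eyinkLongitudinalIntegrand φ ε u x ξ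

/-- **Eyink's mollified transverse flux**
`D_T^ε(u)(x) = (d/(4(d−1))) ∫_{ℝ^d} {∇φ^ε(ξ) · δu(x;ξ) |δu_T|² − (2/|ξ|) φ^ε(ξ) δu_L |δu_T|²} dξ`
(Eyink 2003, Thm. 1, with `⅜` in `d = 3`). Bochner integral in `ξ`. [cite: Eyink2003, §2 Thm. 1] -/
def eyinkTransverseApprox (φ : EuclideanSpace ℝ d → ℝ) (ε : ℝ)
    (u : UnitAddTorus d → EuclideanSpace ℝ d) (x : UnitAddTorus d) : ℝ :=
  eyinkTransverseConst d * ∫ ξ, eyinkTransverseIntegrand φ ε u x ξ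

/-- **The two integrands recombine to Duchon–Robert's**: for `ξ ≠ 0`,
`{∇φ^ε·δu (δu_L)² + (2/|ξ|)φ^ε δu_L|δu_T|²} + {∇φ^ε·δu |δu_T|² − (2/|ξ|)φ^ε δu_L|δu_T|²}
  = ∇φ^ε(ξ)·δu |δu|²`,
the pointwise form of `u_L^ε + u_T^ε = u^ε` / `(4/3) D_L^ε + (8/3) D_T^ε = 4 D_ε` (Eyink 2003,
proof of Thm. 1; `Torus.duchonRobertApprox φ ε u x = ¼ ∫ ∇φ^ε·δu |δu|²`). [cite: Eyink2003, §2 Thm. 1] -/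
theorem eyink_integrand_add (φ : EuclideanSpace ℝ d → ℝ) (ε : ℝ)
    (u : UnitAddTorus d → EuclideanSpace ℝ d) (x : UnitAddTorus d) {ξ : EuclideanSpace ℝ d}
    (hξ : ξ ≠ 0) :
    eyinkLongitudinalIntegrand φ ε u x ξ + eyinkTransverseIntegrand φ ε u x ξ =
      ⟪_root_.gradient (FluidPDE.mollifierScale ε φ) ξ, increment u ξ x⟫ * ‖increment u ξ x‖ ^ 2 := by
  rw [eyinkLongitudinalIntegrand, eyinkTransverseIntegrand, norm_sq_increment_eq hξ]
  ring

/-! ## The printed statements (dimension three) -/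

section DimThree

-- the three-dimensional flat torus `T³` and velocity space `ℝ³`
local notation "𝕋³" => UnitAddTorus (Fin 3)
local notation "E³" => EuclideanSpace ℝ (Fin 3)

/-- **Eyink 2003, Theorem 1 (the mollified local 4/5- and 4/15-laws).** Let
`u ∈ L³([0,T] × T³)` be a weak solution of the incompressible Euler equations on `T³` with
Duchon–Robert defect `D` (`Torus.HasDuchonRobertDefect T u D`, the distribution of Duchon–Robert
2000, Prop. 2 / Eyink 2003, (1.1)–(1.2)), and let `φ` be a spherically symmetric mollifier
(`C^∞`, compact support, nonnegative, unit integral). Then `D_L^ε(u) → D(u)` and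
`D_T^ε(u) → D(u)` in the sense of distributions on `(0,T) × T³` as `ε → 0⁺`:
for every test function `ψ`, `∫₀ᵀ∫ D_X^ε(u) ψ → D ψ`, `X = L, T`. [cite: Eyink2003, §2 Thm. 1] -/
def HasDuchonRobertDefect.eyinkApprox_tendsto : Prop :=
  ∀ {T : ℝ} {u : ℝ → 𝕋³ → E³} {D : STFunctional (Fin 3)} (_h : HasDuchonRobertDefect T u D)
    (_hE : FunctionSpaces.Torus.IsWeakEulerSolutionOn T u) (_hu3 : ∫⁻ t in Ioo 0 T, ∫⁻ x, ‖u t x‖ₑ ^ (3 : ℕ) < ∞)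
    {φ : E³ → ℝ} (_hφ : FluidPDE.IsMollifier φ) (_hrad : ∀ ξ η, ‖ξ‖ = ‖η‖ → φ ξ = φ η)
    {ψ : ℝ → 𝕋³ → ℝ} (_hψ : FunctionSpaces.Torus.IsSpaceTimeTestIoo T ψ),
    Tendsto (fun ε => ∫ t in Ioo 0 T, ∫ x, eyinkLongitudinalApprox φ ε (u t) x * ψ t x)
        (𝓝[>] 0) (𝓝 (D ψ)) ∧
      Tendsto (fun ε => ∫ t in Ioo 0 T, ∫ x, eyinkTransverseApprox φ ε (u t) x * ψ t x)
        (𝓝[>] 0) (𝓝 (D ψ))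

end DimThree

/-! ## Corollary 1 from Theorem 1, in dimension `d ≥ 2` -/

section CorollaryOne

variable {T : ℝ} {u : ℝ → UnitAddTorus d → EuclideanSpace ℝ d} {ψ : ℝ → UnitAddTorus d → ℝ}
  {Q : EuclideanSpace ℝ d → EuclideanSpace ℝ d → ℝ} {CQ Cψ : ℝ}

/-- **Radial kernels with a `1/|ξ|` singularity are integrable in dimension `≥ 2`**: for a
continuous profile `X` vanishing for `|r| > R`, `ξ ↦ |ξ|⁻¹ X(|ξ|)` is in `L¹(ℝ^d)` when `d ≥ 2`
(polar coordinates: `r^{d-1} · r⁻¹ X(r) = r^{d-2} X(r)` is continuous). [folklore] -/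
theorem integrable_inv_norm_mul_radial [Nonempty d] (hn : 2 ≤ Fintype.card d) {X : ℝ → ℝ}
    (hX : Continuous X) {R : ℝ} (hsupp : ∀ r, R < |r| → X r = 0) :
    Integrable (fun ξ : EuclideanSpace ℝ d => ‖ξ‖⁻¹ * X ‖ξ‖) volume := by
  have h := (integrable_fun_norm_addHaar (volume : Measure (EuclideanSpace ℝ d))
    (f := fun y : ℝ => y⁻¹ * X y)).2
  refine h ?_
  have hcongr : ∀ y ∈ Ioi (0 : ℝ),
      y ^ (finrank ℝ (EuclideanSpace ℝ d) - 1) • (y⁻¹ * X y) = y ^ (Fintype.card d - 2) * X y := by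
    intro y hy
    have hy0 : (y : ℝ) ≠ 0 := (ne_of_gt hy)
    rw [finrank_euclideanSpace, smul_eq_mul]
    have : y ^ (Fintype.card d - 1) = y ^ (Fintype.card d - 2) * y := by
      rw [← pow_succ]; congr 1; omega
    rw [this]
    field_simp
  rw [integrableOn_congr_fun hcongr measurableSet_Ioi]
  refine (Continuous.integrable_of_hasCompactSupport ((continuous_pow _).mul hX) ?_).integrableOn
  refine HasCompactSupport.intro (isCompact_Icc (a := -|R|) (b := |R|)) fun y hy => ?_
  show y ^ (Fintype.card d - 2) * X y = 0
  rw [hsupp y ?_, mul_zero]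
  simp only [mem_Icc, not_and_or, not_le] at hy
  rcases hy with hy | hy
  · calc R ≤ |R| := le_abs_self R
      _ < -y := by linarith
      _ ≤ |y| := neg_le_abs y
  · calc R ≤ |R| := le_abs_self R
      _ < y := hy
      _ ≤ |y| := le_abs_self y

/-- **Shell pairings, iterated versus product form**: for every scale `ℓ`,
`∫₀ᵀ∫ ℓ⁻¹ ⨍ Q(ω, δu(t,x;ℓω)) dω ψ = ℓ⁻¹ ∫_{(0,T)×T^d} ⨍ Q(ω, δu(·;ℓω)) dω ψ` (Fubini; the integrand
is integrable by `integrable_sphere_increment`). [folklore] -/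
theorem integral_integral_sphereAvg_eq [Nonempty d]
    (hu : AEStronglyMeasurable (uncurry u) ((volume.restrict (Ioo 0 T)).prod volume))
    (hu3 : ∫⁻ p, ‖uncurry u p‖ₑ ^ 3 ∂((volume.restrict (Ioo 0 T)).prod volume) < ∞)
    (hψm : AEStronglyMeasurable (uncurry ψ) ((volume.restrict (Ioo 0 T)).prod volume))
    (hψb : ∀ t x, |ψ t x| ≤ Cψ)
    (hQc : Continuous (uncurry Q)) (hCQ : 0 ≤ CQ) (hQ : ∀ ω v, ‖ω‖ ≤ 1 → |Q ω v| ≤ CQ * ‖v‖ ^ 3)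
    (ℓ : ℝ) :
    ∫ t in Ioo 0 T, ∫ x, ℓ⁻¹ * sphereAvg (fun y => Q y (increment (u t) (ℓ • y) x)) * ψ t x =
      ℓ⁻¹ * ∫ p, sphereAvg (fun y => Q y (increment (u p.1) (ℓ • y) p.2)) * ψ p.1 p.2
        ∂((volume.restrict (Ioo 0 T)).prod volume) := by
  set μp : Measure (ℝ × UnitAddTorus d) := (volume.restrict (Ioo 0 T)).prod volume with hμp
  have hc := (toSphere_real_univ_pos (d := d)).ne'
  have hS' := integrable_sphere_increment hu hu3 hψm hψb hQc hCQ hQ ℓ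
  have hint : Integrable (fun p : ℝ × UnitAddTorus d =>
      sphereAvg (fun y => Q y (increment (u p.1) (ℓ • y) p.2)) * ψ p.1 p.2) μp := by
    have h1 := hS'.integral_prod_left
    have h2 : ∀ p : ℝ × UnitAddTorus d,
        ∫ ω : sphere (0 : EuclideanSpace ℝ d) 1,
            Q ω (increment (u p.1) (ℓ • (ω : EuclideanSpace ℝ d)) p.2) * ψ p.1 p.2 ∂volume.toSphere =
          (volume : Measure (EuclideanSpace ℝ d)).toSphere.real univ *
            (sphereAvg (fun y => Q y (increment (u p.1) (ℓ • y) p.2)) * ψ p.1 p.2) := fun p => by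
      rw [integral_mul_const,
        integral_sphere_eq_mul_sphereAvg (fun y => Q y (increment (u p.1) (ℓ • y) p.2)), mul_assoc]
    refine ((h1.congr (ae_of_all _ h2)).const_mul
      ((volume : Measure (EuclideanSpace ℝ d)).toSphere.real univ)⁻¹).congr (ae_of_all _ fun p => ?_)
    simp only
    rw [← mul_assoc, inv_mul_cancel₀ hc, one_mul]
  have e1 : ∫ t in Ioo 0 T, ∫ x, ℓ⁻¹ * (sphereAvg (fun y => Q y (increment (u t) (ℓ • y) x)) * ψ t x) =
      ∫ p, ℓ⁻¹ * (sphereAvg (fun y => Q y (increment (u p.1) (ℓ • y) p.2)) * ψ p.1 p.2) ∂μp :=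
    (integral_prod _ (hint.const_mul ℓ⁻¹)).symm
  simp only [mul_assoc]
  rw [e1, integral_const_mul]

/-- The cubic form `Q_L(ω, v) = ⟪v, ω⟫³` of the longitudinal flux is continuous and bounded by
`|v|³` for `|ω| ≤ 1`. [folklore] -/
theorem continuous_cubicFormL :
    Continuous (uncurry fun (ω v : EuclideanSpace ℝ d) => ⟪v, ω⟫ ^ 3) :=
  (continuous_snd.inner continuous_fst).pow 3

/-- `|⟪v, ω⟫³| ≤ |v|³` for `|ω| ≤ 1`. [folklore] -/
theorem abs_cubicFormL_le {ω : EuclideanSpace ℝ d} (v : EuclideanSpace ℝ d) (hω : ‖ω‖ ≤ 1) :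
    |⟪v, ω⟫ ^ 3| ≤ 1 * ‖v‖ ^ 3 := by
  rw [one_mul, abs_pow]
  refine pow_le_pow_left₀ (abs_nonneg _) ?_ 3
  calc |⟪v, ω⟫| ≤ ‖v‖ * ‖ω‖ := abs_real_inner_le_norm v ω
    _ ≤ ‖v‖ * 1 := by gcongr
    _ = ‖v‖ := mul_one _

/-- The mixed cubic form `Q_T(ω, v) = ⟪v, ω⟫ |v − ⟪v, ω⟫ ω|²` is continuous. [folklore] -/
theorem continuous_cubicFormT :
    Continuous (uncurry fun (ω v : EuclideanSpace ℝ d) => ⟪v, ω⟫ * ‖v - ⟪v, ω⟫ • ω‖ ^ 2) := by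
  have h1 : Continuous fun p : EuclideanSpace ℝ d × EuclideanSpace ℝ d => ⟪p.2, p.1⟫ :=
    continuous_snd.inner continuous_fst
  have h2 : Continuous fun p : EuclideanSpace ℝ d × EuclideanSpace ℝ d => p.2 - ⟪p.2, p.1⟫ • p.1 :=
    continuous_snd.sub (h1.smul continuous_fst)
  exact h1.mul (h2.norm.pow 2)

/-- `|⟪v, ω⟫| |v − ⟪v, ω⟫ ω|² ≤ 4 |v|³` for `|ω| ≤ 1`. [folklore] -/
theorem abs_cubicFormT_le {ω : EuclideanSpace ℝ d} (v : EuclideanSpace ℝ d) (hω : ‖ω‖ ≤ 1) :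
    |⟪v, ω⟫ * ‖v - ⟪v, ω⟫ • ω‖ ^ 2| ≤ 4 * ‖v‖ ^ 3 := by
  have h1 : |⟪v, ω⟫| ≤ ‖v‖ := by
    calc |⟪v, ω⟫| ≤ ‖v‖ * ‖ω‖ := abs_real_inner_le_norm v ω
      _ ≤ ‖v‖ * 1 := by gcongr
      _ = ‖v‖ := mul_one _
  have h2 : ‖v - ⟪v, ω⟫ • ω‖ ≤ 2 * ‖v‖ := by
    calc ‖v - ⟪v, ω⟫ • ω‖ ≤ ‖v‖ + ‖⟪v, ω⟫ • ω‖ := norm_sub_le _ _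
      _ = ‖v‖ + |⟪v, ω⟫| * ‖ω‖ := by rw [norm_smul, Real.norm_eq_abs]
      _ ≤ ‖v‖ + ‖v‖ * 1 := by gcongr
      _ = 2 * ‖v‖ := by ring
  rw [abs_mul, abs_of_nonneg (pow_nonneg (norm_nonneg _) 2)]
  calc |⟪v, ω⟫| * ‖v - ⟪v, ω⟫ • ω‖ ^ 2 ≤ ‖v‖ * (2 * ‖v‖) ^ 2 := by gcongr
    _ = 4 * ‖v‖ ^ 3 := by ring

open scoped ContDiff in
/-- **Eyink's integrands in kernel form.** For a smooth radial `φ` with profile `Φ` and every `ξ`,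
`{∇φ^ε·δu (δu_L)² + (2/|ξ|)φ^ε δu_L|δu_T|²} = k_ε(|ξ|) Q_L(ξ̂, δu) + m_ε(|ξ|) Q_T(ξ̂, δu)` and
`{∇φ^ε·δu |δu_T|² − (2/|ξ|)φ^ε δu_L|δu_T|²} = k_ε(|ξ|) Q_T(ξ̂, δu) − m_ε(|ξ|) Q_T(ξ̂, δu)`, with
`k_ε(r) = ε^{-d} ε⁻¹ Φ'(r/ε)`, `m_ε(r) = r⁻¹ · 2 ε^{-d} Φ(r/ε)` (Eyink 2003, proof of Cor. 1). [cite: Eyink2003, §2 Cor. 1] -/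
theorem eyink_integrands_eq_kernel {φ : EuclideanSpace ℝ d → ℝ} (hφ : ContDiff ℝ ∞ φ)
    (hrad : ∀ x y, ‖x‖ = ‖y‖ → φ x = φ y) {e₀ : EuclideanSpace ℝ d} (he₀ : ‖e₀‖ = 1)
    (ε : ℝ) (w : UnitAddTorus d → EuclideanSpace ℝ d) (x : UnitAddTorus d)
    (ξ : EuclideanSpace ℝ d) :
    eyinkLongitudinalIntegrand φ ε w x ξ =
        (ε ^ Fintype.card d)⁻¹ * (ε⁻¹ * deriv (fun r : ℝ => φ (r • e₀)) (ε⁻¹ * ‖ξ‖)) *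
            ⟪increment w ξ x, ‖ξ‖⁻¹ • ξ⟫ ^ 3 +
          ‖ξ‖⁻¹ * (2 * ((ε ^ Fintype.card d)⁻¹ * φ ((ε⁻¹ * ‖ξ‖) • e₀))) *
            (⟪increment w ξ x, ‖ξ‖⁻¹ • ξ⟫ *
              ‖increment w ξ x - ⟪increment w ξ x, ‖ξ‖⁻¹ • ξ⟫ • (‖ξ‖⁻¹ • ξ)‖ ^ 2) ∧
      eyinkTransverseIntegrand φ ε w x ξ =
        (ε ^ Fintype.card d)⁻¹ * (ε⁻¹ * deriv (fun r : ℝ => φ (r • e₀)) (ε⁻¹ * ‖ξ‖)) *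
            (⟪increment w ξ x, ‖ξ‖⁻¹ • ξ⟫ *
              ‖increment w ξ x - ⟪increment w ξ x, ‖ξ‖⁻¹ • ξ⟫ • (‖ξ‖⁻¹ • ξ)‖ ^ 2) -
          ‖ξ‖⁻¹ * (2 * ((ε ^ Fintype.card d)⁻¹ * φ ((ε⁻¹ * ‖ξ‖) • e₀))) *
            (⟪increment w ξ x, ‖ξ‖⁻¹ • ξ⟫ *
              ‖increment w ξ x - ⟪increment w ξ x, ‖ξ‖⁻¹ • ξ⟫ • (‖ξ‖⁻¹ • ξ)‖ ^ 2) := by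
  by_cases hξ : ξ = 0
  · subst hξ
    simp [eyinkLongitudinalIntegrand, eyinkTransverseIntegrand]
  · have hgrad := inner_gradient_mollifierScale hφ hrad he₀ ε hξ (increment w ξ x)
    rw [← real_inner_comm (‖ξ‖⁻¹ • ξ) (increment w ξ x)] at hgrad
    have hφε : FluidPDE.mollifierScale ε φ ξ = (ε ^ Fintype.card d)⁻¹ * φ ((ε⁻¹ * ‖ξ‖) • e₀) := by
      rw [FluidPDE.mollifierScale_apply, hrad (ε⁻¹ • ξ) ((ε⁻¹ * ‖ξ‖) • e₀)]
      rw [norm_smul, norm_smul, he₀, mul_one, Real.norm_eq_abs, Real.norm_eq_abs, abs_mul,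
        abs_of_nonneg (norm_nonneg ξ)]
    rw [eyinkLongitudinalIntegrand, eyinkTransverseIntegrand, transverseIncrement,
      longitudinalIncrement, hgrad, hφε]
    constructor <;> ring

/-- The sphere average of the cubic form `Q_L` is the longitudinal flux (definitional). [folklore] -/
theorem sphereAvg_cubicFormL (w : UnitAddTorus d → EuclideanSpace ℝ d) (r : ℝ) (x : UnitAddTorus d) :
    sphereAvg (fun y => ⟪increment w (r • y) x, y⟫ ^ 3) = longitudinalFluxSphereAvg w r x := rfl

/-- The sphere average of the cubic form `Q_T` is the mixed flux (definitional). [folklore] -/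
theorem sphereAvg_cubicFormT (w : UnitAddTorus d → EuclideanSpace ℝ d) (r : ℝ) (x : UnitAddTorus d) :
    sphereAvg (fun y => ⟪increment w (r • y) x, y⟫ *
      ‖increment w (r • y) x - ⟪increment w (r • y) x, y⟫ • y‖ ^ 2) = mixedFluxSphereAvg w r x := rfl

/-- **Eyink's mollified fluxes as rescaled averages of shell pairings** (Eyink 2003, proof of
Cor. 1, general dimension): for a smooth radial mollifier `φ` supported in the unit ball, with
profile `Φ(r) = φ(r e₀)`, and `ε > 0`,
`∫∫ D_L^ε(u) ψ = (d/4)|S^{d-1}| [∫_{x>0} x^d Φ'(x) G_L(εx) dx + ∫_{x>0} 2x^{d-1} Φ(x) G_T(εx) dx]`,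
`∫∫ D_T^ε(u) ψ = (d/(4(d−1)))|S^{d-1}| [∫ x^d Φ'(x) G_T(εx) − ∫ 2x^{d-1} Φ(x) G_T(εx)]`, where
`G_L(ℓ) = ℓ⁻¹ ∫∫ ⟨(δu_L)³⟩_{ang}(ℓ) ψ` and `G_T(ℓ) = ℓ⁻¹ ∫∫ ⟨δu_L |δu_T|²⟩_{ang}(ℓ) ψ` (space–time
integrals over the product measure on `(0,T) × T^d`; `d ≥ 2` for the `1/|ξ|` kernel). [cite: Eyink2003, §2 Cor. 1] -/
theorem integral_eyinkApprox_eq [Nonempty d] (hn2 : 2 ≤ Fintype.card d)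
    {φ : EuclideanSpace ℝ d → ℝ} (hφ : FluidPDE.IsMollifier φ)
    (hrad : ∀ x y, ‖x‖ = ‖y‖ → φ x = φ y) (hφsupp : ∀ x, 1 < ‖x‖ → φ x = 0)
    {e₀ : EuclideanSpace ℝ d} (he₀ : ‖e₀‖ = 1)
    (hu : AEStronglyMeasurable (uncurry u) ((volume.restrict (Ioo 0 T)).prod volume))
    (hu3 : ∫⁻ p, ‖uncurry u p‖ₑ ^ 3 ∂((volume.restrict (Ioo 0 T)).prod volume) < ∞)
    (hψm : AEStronglyMeasurable (uncurry ψ) ((volume.restrict (Ioo 0 T)).prod volume))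
    (hψb : ∀ t x, |ψ t x| ≤ Cψ) {ε : ℝ} (hε : 0 < ε) :
    (∫ t in Ioo 0 T, ∫ x, eyinkLongitudinalApprox φ ε (u t) x * ψ t x =
      eyinkLongitudinalConst d * (volume : Measure (EuclideanSpace ℝ d)).toSphere.real univ *
        ((∫ x in Ioi (0 : ℝ), x ^ Fintype.card d * deriv (fun r : ℝ => φ (r • e₀)) x *
            ((ε * x)⁻¹ * ∫ p, longitudinalFluxSphereAvg (u p.1) (ε * x) p.2 * ψ p.1 p.2
              ∂((volume.restrict (Ioo 0 T)).prod volume))) +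
          ∫ x in Ioi (0 : ℝ), 2 * x ^ (Fintype.card d - 1) * φ (x • e₀) *
            ((ε * x)⁻¹ * ∫ p, mixedFluxSphereAvg (u p.1) (ε * x) p.2 * ψ p.1 p.2
              ∂((volume.restrict (Ioo 0 T)).prod volume)))) ∧
    (∫ t in Ioo 0 T, ∫ x, eyinkTransverseApprox φ ε (u t) x * ψ t x =
      eyinkTransverseConst d * (volume : Measure (EuclideanSpace ℝ d)).toSphere.real univ *
        ((∫ x in Ioi (0 : ℝ), x ^ Fintype.card d * deriv (fun r : ℝ => φ (r • e₀)) x *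
            ((ε * x)⁻¹ * ∫ p, mixedFluxSphereAvg (u p.1) (ε * x) p.2 * ψ p.1 p.2
              ∂((volume.restrict (Ioo 0 T)).prod volume))) -
          ∫ x in Ioi (0 : ℝ), 2 * x ^ (Fintype.card d - 1) * φ (x • e₀) *
            ((ε * x)⁻¹ * ∫ p, mixedFluxSphereAvg (u p.1) (ε * x) p.2 * ψ p.1 p.2
              ∂((volume.restrict (Ioo 0 T)).prod volume)))) := by
  set μp : Measure (ℝ × UnitAddTorus d) := (volume.restrict (Ioo 0 T)).prod volume with hμp
  set Φ : ℝ → ℝ := fun r => φ (r • e₀) with hΦ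
  set n : ℕ := Fintype.card d with hndef
  have hn : 1 ≤ n := Fintype.card_pos
  set c : ℝ := (volume : Measure (EuclideanSpace ℝ d)).toSphere.real univ with hcdef
  have h1m : AEStronglyMeasurable (uncurry fun (_ : ℝ) (_ : UnitAddTorus d) => (1 : ℝ)) μp :=
    aestronglyMeasurable_const
  have h1b : ∀ (t : ℝ) (x : UnitAddTorus d), |(fun (_ : ℝ) (_ : UnitAddTorus d) => (1 : ℝ)) t x| ≤ 1 :=
    fun _ _ => by simp
  -- the cubic forms
  have hQLc : Continuous (uncurry fun (ω v : EuclideanSpace ℝ d) => ⟪v, ω⟫ ^ 3) := continuous_cubicFormL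
  have hQL : ∀ ω v : EuclideanSpace ℝ d, ‖ω‖ ≤ 1 →
      |(fun (ω v : EuclideanSpace ℝ d) => ⟪v, ω⟫ ^ 3) ω v| ≤ 1 * ‖v‖ ^ 3 :=
    fun ω v hω => abs_cubicFormL_le v hω
  have hQTc : Continuous (uncurry fun (ω v : EuclideanSpace ℝ d) => ⟪v, ω⟫ * ‖v - ⟪v, ω⟫ • ω‖ ^ 2) :=
    continuous_cubicFormT
  have hQT : ∀ ω v : EuclideanSpace ℝ d, ‖ω‖ ≤ 1 →
      |(fun (ω v : EuclideanSpace ℝ d) => ⟪v, ω⟫ * ‖v - ⟪v, ω⟫ • ω‖ ^ 2) ω v| ≤ 4 * ‖v‖ ^ 3 :=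
    fun ω v hω => abs_cubicFormT_le v hω
  have h4 : (0 : ℝ) ≤ 4 := by norm_num
  -- profile facts
  have hΦ1 : ContDiff ℝ 1 Φ := (hφ.1.of_le (by simp)).comp (contDiff_id.smul contDiff_const)
  have hΦc : Continuous Φ := hΦ1.continuous
  have hΦsupp : ∀ r, 1 < |r| → Φ r = 0 := fun r hr =>
    hφsupp _ (by rw [norm_smul, he₀, mul_one, Real.norm_eq_abs]; exact hr)
  have hΦ'supp : ∀ r, 1 < r → deriv Φ r = 0 := fun r hr =>
    deriv_eq_zero_of_forall_gt (fun s hs => hΦsupp s (hs.trans_le (le_abs_self s))) hr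
  have hΦ'c : Continuous (deriv Φ) := hΦ1.continuous_deriv le_rfl
  -- kernels
  set kε : ℝ → ℝ := fun r => (ε ^ n)⁻¹ * (ε⁻¹ * deriv Φ (ε⁻¹ * r)) with hkε
  set mε : ℝ → ℝ := fun r => r⁻¹ * (2 * ((ε ^ n)⁻¹ * Φ (ε⁻¹ * r))) with hmε
  have hkint : Integrable (fun ξ : EuclideanSpace ℝ d => kε ‖ξ‖) volume := by
    have hkcont : Continuous kε :=
      continuous_const.mul (continuous_const.mul (hΦ'c.comp (continuous_const.mul continuous_id)))
    refine (hkcont.comp continuous_norm).integrable_of_hasCompactSupport ?_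
    refine HasCompactSupport.intro (isCompact_closedBall (0 : EuclideanSpace ℝ d) ε) fun ξ hξ => ?_
    have hξ' : ε < ‖ξ‖ := by simpa [dist_zero_right] using hξ
    show (ε ^ n)⁻¹ * (ε⁻¹ * deriv Φ (ε⁻¹ * ‖ξ‖)) = 0
    rw [hΦ'supp _ (by rw [← div_eq_inv_mul, one_lt_div hε]; exact hξ'), mul_zero, mul_zero]
  have hmint : Integrable (fun ξ : EuclideanSpace ℝ d => mε ‖ξ‖) volume := by
    have hX : Continuous fun y : ℝ => 2 * ((ε ^ n)⁻¹ * Φ (ε⁻¹ * y)) :=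
      continuous_const.mul (continuous_const.mul (hΦc.comp (continuous_const.mul continuous_id)))
    refine integrable_inv_norm_mul_radial hn2 (R := ε) hX fun r hr => ?_
    show 2 * ((ε ^ n)⁻¹ * Φ (ε⁻¹ * r)) = 0
    rw [hΦsupp _ ?_, mul_zero, mul_zero]
    rw [abs_mul, abs_inv, abs_of_pos hε, ← div_eq_inv_mul, one_lt_div hε]
    exact hr
  -- the six product-integrable functions (with `ψ` and with `1`)
  have hF1 := integrable_kernel_increment hu hu3 hψm hψb hQLc zero_le_one hQL hkint
  have hF2 := integrable_kernel_increment hu hu3 hψm hψb hQTc h4 hQT hmint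
  have hF3 := integrable_kernel_increment hu hu3 hψm hψb hQTc h4 hQT hkint
  have hF1' := integrable_kernel_increment hu hu3 h1m h1b hQLc zero_le_one hQL hkint
  have hF2' := integrable_kernel_increment hu hu3 h1m h1b hQTc h4 hQT hmint
  have hF3' := integrable_kernel_increment hu hu3 h1m h1b hQTc h4 hQT hkint
  simp only [mul_one] at hF1' hF2' hF3'
  -- pointwise kernel form of the integrands
  have hptL : ∀ (t : ℝ) (x : UnitAddTorus d) (ξ : EuclideanSpace ℝ d),
      eyinkLongitudinalIntegrand φ ε (u t) x ξ =
        kε ‖ξ‖ * (fun (ω v : EuclideanSpace ℝ d) => ⟪v, ω⟫ ^ 3) (‖ξ‖⁻¹ • ξ) (increment (u t) ξ x) +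
          mε ‖ξ‖ * (fun (ω v : EuclideanSpace ℝ d) => ⟪v, ω⟫ * ‖v - ⟪v, ω⟫ • ω‖ ^ 2)
            (‖ξ‖⁻¹ • ξ) (increment (u t) ξ x) := fun t x ξ =>
    (eyink_integrands_eq_kernel hφ.1 hrad he₀ ε (u t) x ξ).1
  have hptT : ∀ (t : ℝ) (x : UnitAddTorus d) (ξ : EuclideanSpace ℝ d),
      eyinkTransverseIntegrand φ ε (u t) x ξ =
        kε ‖ξ‖ * (fun (ω v : EuclideanSpace ℝ d) => ⟪v, ω⟫ * ‖v - ⟪v, ω⟫ • ω‖ ^ 2)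
            (‖ξ‖⁻¹ • ξ) (increment (u t) ξ x) -
          mε ‖ξ‖ * (fun (ω v : EuclideanSpace ℝ d) => ⟪v, ω⟫ * ‖v - ⟪v, ω⟫ • ω‖ ^ 2)
            (‖ξ‖⁻¹ • ξ) (increment (u t) ξ x) := fun t x ξ =>
    (eyink_integrands_eq_kernel hφ.1 hrad he₀ ε (u t) x ξ).2
  -- a.e. splitting of the `ξ`-integrals
  have haeL : ∀ᵐ p : ℝ × UnitAddTorus d ∂μp,
      (∫ ξ, eyinkLongitudinalIntegrand φ ε (u p.1) p.2 ξ) * ψ p.1 p.2 =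
        (∫ ξ, kε ‖ξ‖ * (fun (ω v : EuclideanSpace ℝ d) => ⟪v, ω⟫ ^ 3) (‖ξ‖⁻¹ • ξ)
            (increment (u p.1) ξ p.2)) * ψ p.1 p.2 +
          (∫ ξ, mε ‖ξ‖ * (fun (ω v : EuclideanSpace ℝ d) => ⟪v, ω⟫ * ‖v - ⟪v, ω⟫ • ω‖ ^ 2)
            (‖ξ‖⁻¹ • ξ) (increment (u p.1) ξ p.2)) * ψ p.1 p.2 := by
    filter_upwards [hF1'.prod_right_ae, hF2'.prod_right_ae] with p h1 h2
    rw [← add_mul, ← integral_add h1 h2]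
    congr 1
    exact integral_congr_ae (ae_of_all _ fun ξ => hptL p.1 p.2 ξ)
  have haeT : ∀ᵐ p : ℝ × UnitAddTorus d ∂μp,
      (∫ ξ, eyinkTransverseIntegrand φ ε (u p.1) p.2 ξ) * ψ p.1 p.2 =
        (∫ ξ, kε ‖ξ‖ * (fun (ω v : EuclideanSpace ℝ d) => ⟪v, ω⟫ * ‖v - ⟪v, ω⟫ • ω‖ ^ 2)
            (‖ξ‖⁻¹ • ξ) (increment (u p.1) ξ p.2)) * ψ p.1 p.2 -
          (∫ ξ, mε ‖ξ‖ * (fun (ω v : EuclideanSpace ℝ d) => ⟪v, ω⟫ * ‖v - ⟪v, ω⟫ • ω‖ ^ 2)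
            (‖ξ‖⁻¹ • ξ) (increment (u p.1) ξ p.2)) * ψ p.1 p.2 := by
    filter_upwards [hF3'.prod_right_ae, hF2'.prod_right_ae] with p h3 h2
    rw [← sub_mul, ← integral_sub h3 h2]
    congr 1
    exact integral_congr_ae (ae_of_all _ fun ξ => hptT p.1 p.2 ξ)
  -- the marginals are integrable
  have hm1 := hF1.integral_prod_left
  have hm2 := hF2.integral_prod_left
  have hm3 := hF3.integral_prod_left
  simp only [integral_mul_const] at hm1 hm2 hm3
  have hmL : Integrable (fun p : ℝ × UnitAddTorus d =>
      (∫ ξ, eyinkLongitudinalIntegrand φ ε (u p.1) p.2 ξ) * ψ p.1 p.2) μp :=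
    (hm1.add hm2).congr (haeL.mono fun p hp => hp.symm)
  have hmT : Integrable (fun p : ℝ × UnitAddTorus d =>
      (∫ ξ, eyinkTransverseIntegrand φ ε (u p.1) p.2 ξ) * ψ p.1 p.2) μp :=
    (hm3.sub hm2).congr (haeT.mono fun p hp => hp.symm)
  -- the three polar identities
  have hP1 := integral_kernel_increment_eq_polar hu hu3 hψm hψb hQLc zero_le_one hQL hkint
  have hP2 := integral_kernel_increment_eq_polar hu hu3 hψm hψb hQTc h4 hQT hmint
  have hP3 := integral_kernel_increment_eq_polar hu hu3 hψm hψb hQTc h4 hQT hkint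
  -- the substitutions `r = ε x`
  have hsubk : ∀ I : ℝ → ℝ, ∫ r in Ioi (0 : ℝ), r ^ (n - 1) * kε r * I r =
      ∫ x in Ioi (0 : ℝ), x ^ n * deriv Φ x * ((ε * x)⁻¹ * I (ε * x)) := by
    intro I
    have hsub := integral_comp_mul_left_Ioi (fun r => r ^ (n - 1) * kε r * I r) 0 hε
    rw [mul_zero] at hsub
    have e2 : ∫ r in Ioi (0 : ℝ), r ^ (n - 1) * kε r * I r =
        ε * ∫ x in Ioi (0 : ℝ), (ε * x) ^ (n - 1) * kε (ε * x) * I (ε * x) := by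
      rw [hsub, smul_eq_mul, ← mul_assoc, mul_inv_cancel₀ hε.ne', one_mul]
    rw [e2, ← integral_const_mul]
    refine setIntegral_congr_fun measurableSet_Ioi fun x hx => ?_
    have hx0 : (0 : ℝ) < x := hx
    simp only [hkε]
    have hεn : ε ^ n = ε ^ (n - 1) * ε := (pow_sub_one_mul (by omega) ε).symm
    have hxn : x ^ n = x ^ (n - 1) * x := (pow_sub_one_mul (by omega) x).symm
    rw [show ε⁻¹ * (ε * x) = x by field_simp, mul_pow, hεn, hxn]
    field_simp
  have hsubm : ∀ I : ℝ → ℝ, ∫ r in Ioi (0 : ℝ), r ^ (n - 1) * mε r * I r =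
      ∫ x in Ioi (0 : ℝ), 2 * x ^ (n - 1) * Φ x * ((ε * x)⁻¹ * I (ε * x)) := by
    intro I
    have hsub := integral_comp_mul_left_Ioi (fun r => r ^ (n - 1) * mε r * I r) 0 hε
    rw [mul_zero] at hsub
    have e2 : ∫ r in Ioi (0 : ℝ), r ^ (n - 1) * mε r * I r =
        ε * ∫ x in Ioi (0 : ℝ), (ε * x) ^ (n - 1) * mε (ε * x) * I (ε * x) := by
      rw [hsub, smul_eq_mul, ← mul_assoc, mul_inv_cancel₀ hε.ne', one_mul]
    rw [e2, ← integral_const_mul]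
    refine setIntegral_congr_fun measurableSet_Ioi fun x hx => ?_
    have hx0 : (0 : ℝ) < x := hx
    simp only [hmε]
    have hεn : ε ^ n = ε ^ (n - 1) * ε := (pow_sub_one_mul (by omega) ε).symm
    rw [show ε⁻¹ * (ε * x) = x by field_simp, mul_pow, hεn]
    field_simp
  -- the sphere averages are the named fluxes (definitional)
  simp only [sphereAvg_cubicFormL] at hP1
  simp only [sphereAvg_cubicFormT] at hP2 hP3
  constructor
  · -- longitudinal
    have hpt : (fun t => ∫ x, eyinkLongitudinalApprox φ ε (u t) x * ψ t x) = fun t =>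
        eyinkLongitudinalConst d * ∫ x, (∫ ξ, eyinkLongitudinalIntegrand φ ε (u t) x ξ) * ψ t x := by
      funext t
      rw [← integral_const_mul]
      refine integral_congr_ae (ae_of_all _ fun x => ?_)
      simp only [eyinkLongitudinalApprox]
      ring
    have e1 : ∫ t in Ioo 0 T, ∫ x, (∫ ξ, eyinkLongitudinalIntegrand φ ε (u t) x ξ) * ψ t x =
        ∫ p, (∫ ξ, eyinkLongitudinalIntegrand φ ε (u p.1) p.2 ξ) * ψ p.1 p.2 ∂μp :=
      (integral_prod _ hmL).symm
    rw [hpt, integral_const_mul, e1, integral_congr_ae haeL, integral_add hm1 hm2, hP1, hP2,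
      hsubk, hsubm]
    ring
  · -- transverse
    have hpt : (fun t => ∫ x, eyinkTransverseApprox φ ε (u t) x * ψ t x) = fun t =>
        eyinkTransverseConst d * ∫ x, (∫ ξ, eyinkTransverseIntegrand φ ε (u t) x ξ) * ψ t x := by
      funext t
      rw [← integral_const_mul]
      refine integral_congr_ae (ae_of_all _ fun x => ?_)
      simp only [eyinkTransverseApprox]
      ring
    have e1 : ∫ t in Ioo 0 T, ∫ x, (∫ ξ, eyinkTransverseIntegrand φ ε (u t) x ξ) * ψ t x =
        ∫ p, (∫ ξ, eyinkTransverseIntegrand φ ε (u p.1) p.2 ξ) * ψ p.1 p.2 ∂μp :=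
      (integral_prod _ hmT).symm
    rw [hpt, integral_const_mul, e1, integral_congr_ae haeT, integral_sub hm3 hm2, hP3, hP2,
      hsubk, hsubm]
    ring

/-- **Corollary 1 from Theorem 1, in dimension `d ≥ 2`** (Eyink 2003, proof of Cor. 1, carried
out in general dimension). Let `φ` be a radial mollifier supported in the closed unit ball, `u`
jointly measurable with `∫∫ |u|³ < ∞`, `ψ` a test function supported in `(0,T) × T^d`. If the
pairings of Eyink's mollified fluxes `D_L^ε(u)`, `D_T^ε(u)` with `ψ` both tend to `D ψ` as
`ε → 0⁺` (the conclusion of Thm. 1) and the shell pairings `∫∫ ℓ⁻¹ ⟨(δu_L)³⟩_{ang} ψ`,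
`∫∫ ℓ⁻¹ ⟨δu_L |δu_T|²⟩_{ang} ψ` tend to `S_L ψ`, `S_T ψ` as `ℓ → 0⁺` (the hypothesis of Cor. 1),
then `S_L ψ = −(12/(d(d+2))) D ψ` and `S_T ψ = −(4(d−1)/(d(d+2))) D ψ` (`−4/5` and `−8/15` for
`d = 3`): dominated convergence in `integral_eyinkApprox_eq` and the kernel integrals
`|S^{d-1}|∫ x^{d-1}Φ = 1`, `∫ x^dΦ' = −d ∫x^{d-1}Φ` yield the linear system
`(4/d) D = −d S_L + 2 S_T`, `(4(d−1)/d) D = −(d+2) S_T`. [cite: Eyink2003, §2 Cor. 1] -/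
theorem eq_of_tendsto_eyinkApprox [Nonempty d] (hn2 : 2 ≤ Fintype.card d)
    {D SL ST : STFunctional d} {φ : EuclideanSpace ℝ d → ℝ} (hφ : FluidPDE.IsMollifier φ)
    (hrad : ∀ x y, ‖x‖ = ‖y‖ → φ x = φ y) (hφsupp : ∀ x, 1 < ‖x‖ → φ x = 0)
    (hum : AEStronglyMeasurable (FunctionSpaces.Torus.stLift u) (volume.restrict (Ioo 0 T ×ˢ univ)))
    (hu3 : ∫⁻ t in Ioo 0 T, ∫⁻ x, ‖u t x‖ₑ ^ (3 : ℕ) < ∞)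
    (hψ : FunctionSpaces.Torus.IsSpaceTimeTestIoo T ψ)
    (hL : Tendsto (fun ε => ∫ t in Ioo 0 T, ∫ x, eyinkLongitudinalApprox φ ε (u t) x * ψ t x)
      (𝓝[>] 0) (𝓝 (D ψ)))
    (hT : Tendsto (fun ε => ∫ t in Ioo 0 T, ∫ x, eyinkTransverseApprox φ ε (u t) x * ψ t x)
      (𝓝[>] 0) (𝓝 (D ψ)))
    (hSL : Tendsto (fun ℓ => ∫ t in Ioo 0 T, ∫ x, ℓ⁻¹ * longitudinalFluxSphereAvg (u t) ℓ x * ψ t x)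
      (𝓝[>] 0) (𝓝 (SL ψ)))
    (hST : Tendsto (fun ℓ => ∫ t in Ioo 0 T, ∫ x, ℓ⁻¹ * mixedFluxSphereAvg (u t) ℓ x * ψ t x)
      (𝓝[>] 0) (𝓝 (ST ψ))) :
    SL ψ = -fourFifthsConst d * D ψ ∧
      ST ψ = -(4 * ((Fintype.card d : ℝ) - 1) / (Fintype.card d * ((Fintype.card d : ℝ) + 2))) * D ψ := by
  -- product-measure form of the hypotheses
  set μp : Measure (ℝ × UnitAddTorus d) := (volume.restrict (Ioo 0 T)).prod volume with hμp
  have hu : AEStronglyMeasurable (uncurry u) μp := aestronglyMeasurable_uncurry_prod_of_stLift_Ioo hum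
  have hu3' : ∫⁻ p, ‖uncurry u p‖ₑ ^ 3 ∂μp < ∞ := lintegral_prod_enorm_pow_three_lt_top hu hu3
  have hψm : AEStronglyMeasurable (uncurry ψ) μp := hψ.continuous_uncurry.aestronglyMeasurable
  obtain ⟨Cψ, hψb⟩ := hψ.exists_abs_le
  -- the two cubic forms
  have hQLc : Continuous (uncurry fun (ω v : EuclideanSpace ℝ d) => ⟪v, ω⟫ ^ 3) := continuous_cubicFormL
  have hQL : ∀ ω v : EuclideanSpace ℝ d, ‖ω‖ ≤ 1 →
      |(fun (ω v : EuclideanSpace ℝ d) => ⟪v, ω⟫ ^ 3) ω v| ≤ 1 * ‖v‖ ^ 3 :=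
    fun ω v hω => abs_cubicFormL_le v hω
  have hQTc : Continuous (uncurry fun (ω v : EuclideanSpace ℝ d) => ⟪v, ω⟫ * ‖v - ⟪v, ω⟫ • ω‖ ^ 2) :=
    continuous_cubicFormT
  have hQT : ∀ ω v : EuclideanSpace ℝ d, ‖ω‖ ≤ 1 →
      |(fun (ω v : EuclideanSpace ℝ d) => ⟪v, ω⟫ * ‖v - ⟪v, ω⟫ • ω‖ ^ 2) ω v| ≤ 4 * ‖v‖ ^ 3 :=
    fun ω v hω => abs_cubicFormT_le v hω
  have h4 : (0 : ℝ) ≤ 4 := by norm_num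
  -- profile, dimension, surface area
  obtain ⟨e₀, he₀⟩ : ∃ e : EuclideanSpace ℝ d, ‖e‖ = 1 := by
    classical
    obtain ⟨i⟩ := ‹Nonempty d›
    exact ⟨EuclideanSpace.single i 1, by simp⟩
  set Φ : ℝ → ℝ := fun r => φ (r • e₀) with hΦ
  have hΦsmooth : ContDiff ℝ 1 Φ := (hφ.1.of_le (by simp)).comp (contDiff_id.smul contDiff_const)
  have hΦc : Continuous Φ := hΦsmooth.continuous
  have hΦsupp : ∀ r, 1 < |r| → Φ r = 0 := fun r hr =>
    hφsupp _ (by rw [norm_smul, he₀, mul_one, Real.norm_eq_abs]; exact hr)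
  have hΦsupp' : ∀ r, 1 < r → Φ r = 0 := fun r hr => hΦsupp r (hr.trans_le (le_abs_self r))
  have hΦ'supp : ∀ r, 1 < r → deriv Φ r = 0 := fun r hr => deriv_eq_zero_of_forall_gt hΦsupp' hr
  have hΦ'c : Continuous (deriv Φ) := hΦsmooth.continuous_deriv le_rfl
  set n : ℕ := Fintype.card d with hndef
  have hn : 1 ≤ n := Fintype.card_pos
  set c : ℝ := (volume : Measure (EuclideanSpace ℝ d)).toSphere.real univ with hcdef
  have hc : 0 < c := toSphere_real_univ_pos
  -- the two shell pairings in product form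
  set gL : ℝ → ℝ := fun ℓ => ℓ⁻¹ * ∫ p, longitudinalFluxSphereAvg (u p.1) ℓ p.2 * ψ p.1 p.2 ∂μp
    with hgLdef
  set gT : ℝ → ℝ := fun ℓ => ℓ⁻¹ * ∫ p, mixedFluxSphereAvg (u p.1) ℓ p.2 * ψ p.1 p.2 ∂μp
    with hgTdef
  have hgLm : AEStronglyMeasurable gL volume :=
    measurable_inv.aestronglyMeasurable.mul
      (aestronglyMeasurable_integral_sphereAvg hu hu3' hψm hψb hQLc zero_le_one hQL)
  have hgTm : AEStronglyMeasurable gT volume :=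
    measurable_inv.aestronglyMeasurable.mul
      (aestronglyMeasurable_integral_sphereAvg hu hu3' hψm hψb hQTc h4 hQT)
  have hgLiter : ∀ ℓ, ∫ t in Ioo 0 T, ∫ x, ℓ⁻¹ * longitudinalFluxSphereAvg (u t) ℓ x * ψ t x = gL ℓ :=
    fun ℓ => integral_integral_sphereAvg_eq hu hu3' hψm hψb hQLc zero_le_one hQL ℓ
  have hgTiter : ∀ ℓ, ∫ t in Ioo 0 T, ∫ x, ℓ⁻¹ * mixedFluxSphereAvg (u t) ℓ x * ψ t x = gT ℓ :=
    fun ℓ => integral_integral_sphereAvg_eq hu hu3' hψm hψb hQTc h4 hQT ℓ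
  have hgLlim : Tendsto gL (𝓝[>] 0) (𝓝 (SL ψ)) := (tendsto_congr hgLiter).1 hSL
  have hgTlim : Tendsto gT (𝓝[>] 0) (𝓝 (ST ψ)) := (tendsto_congr hgTiter).1 hST
  obtain ⟨δL, hδL, ML, hML⟩ := exists_abs_le_of_tendsto_nhdsGT hgLlim
  obtain ⟨δT, hδT, MT, hMT⟩ := exists_abs_le_of_tendsto_nhdsGT hgTlim
  -- Step A: the pairings as rescaled averages (for `ε > 0`)
  have hA := fun (ε : ℝ) (hε : 0 < ε) =>
    integral_eyinkApprox_eq (T := T) (u := u) (ψ := ψ) hn2 hφ hrad hφsupp he₀ hu hu3' hψm hψb hε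
  -- Step B: the limits of the right-hand sides
  have hK1c : Continuous fun x : ℝ => x ^ n * deriv Φ x := (continuous_pow n).mul hΦ'c
  have hK1supp : ∀ x : ℝ, 1 < x → x ^ n * deriv Φ x = 0 := fun x hx => by
    rw [hΦ'supp x hx, mul_zero]
  have hK1int : IntegrableOn (fun x : ℝ => x ^ n * deriv Φ x) (Ioi 0) := by
    refine (hK1c.integrable_of_hasCompactSupport ?_).integrableOn
    refine HasCompactSupport.intro (isCompact_Icc (a := -1) (b := 1)) fun x hx => ?_
    simp only [mem_Icc, not_and_or, not_le] at hx
    rcases hx with hx | hx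
    · have hd : deriv Φ x = 0 := by
        have : deriv Φ x = deriv (fun _ => (0 : ℝ)) x := by
          refine Filter.EventuallyEq.deriv_eq ?_
          filter_upwards [Iio_mem_nhds hx] with s hs
          have hs' : s < -1 := hs
          have hs1 : 1 < |s| := by rw [abs_of_neg (by linarith)]; linarith
          exact hΦsupp s hs1
        rw [this, deriv_const]
      rw [hd, mul_zero]
    · exact hK1supp x hx
  have hK2c : Continuous fun x : ℝ => 2 * x ^ (n - 1) * Φ x :=
    (continuous_const.mul (continuous_pow _)).mul hΦc
  have hK2supp : ∀ x : ℝ, 1 < x → 2 * x ^ (n - 1) * Φ x = 0 := fun x hx => by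
    rw [hΦsupp' x hx, mul_zero]
  have hK2int : IntegrableOn (fun x : ℝ => 2 * x ^ (n - 1) * Φ x) (Ioi 0) := by
    refine (hK2c.integrable_of_hasCompactSupport ?_).integrableOn
    refine HasCompactSupport.intro (isCompact_Icc (a := -1) (b := 1)) fun x hx => ?_
    simp only [mem_Icc, not_and_or, not_le] at hx
    have hx1 : 1 < |x| := by
      rcases hx with hx | hx
      · rw [abs_of_neg (by linarith)]; linarith
      · exact hx.trans_le (le_abs_self x)
    show 2 * x ^ (n - 1) * Φ x = 0
    rw [hΦsupp x hx1, mul_zero]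
  have hlim1L := tendsto_integral_Ioi_mul_comp_mul hK1int hK1supp one_pos hgLm hδL hML hgLlim
  have hlim1T := tendsto_integral_Ioi_mul_comp_mul hK1int hK1supp one_pos hgTm hδT hMT hgTlim
  have hlim2T := tendsto_integral_Ioi_mul_comp_mul hK2int hK2supp one_pos hgTm hδT hMT hgTlim
  set J1 : ℝ := ∫ x in Ioi (0 : ℝ), x ^ n * deriv Φ x with hJ1
  set J2 : ℝ := ∫ x in Ioi (0 : ℝ), 2 * x ^ (n - 1) * Φ x with hJ2
  have hlimL : Tendsto (fun ε => ∫ t in Ioo 0 T, ∫ x, eyinkLongitudinalApprox φ ε (u t) x * ψ t x)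
      (𝓝[>] 0) (𝓝 (eyinkLongitudinalConst d * c * (J1 * SL ψ + J2 * ST ψ))) := by
    refine ((hlim1L.add hlim2T).const_mul (eyinkLongitudinalConst d * c)).congr' ?_
    filter_upwards [self_mem_nhdsWithin] with ε hε using ((hA ε hε).1).symm
  have hlimT : Tendsto (fun ε => ∫ t in Ioo 0 T, ∫ x, eyinkTransverseApprox φ ε (u t) x * ψ t x)
      (𝓝[>] 0) (𝓝 (eyinkTransverseConst d * c * (J1 * ST ψ - J2 * ST ψ))) := by
    refine ((hlim1T.sub hlim2T).const_mul (eyinkTransverseConst d * c)).congr' ?_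
    filter_upwards [self_mem_nhdsWithin] with ε hε using ((hA ε hε).2).symm
  have hDL := tendsto_nhds_unique hL hlimL
  have hDT := tendsto_nhds_unique hT hlimT
  -- Step C: kernel integrals
  set J : ℝ := ∫ x in Ioi (0 : ℝ), x ^ (n - 1) * Φ x with hJ
  have hJ1eq : J1 = -n * J :=
    integral_Ioi_pow_mul_deriv hΦsmooth (R := 2) two_pos (fun r hr => hΦsupp' r (by linarith)) hn
  have hJ2eq : J2 = 2 * J := by
    simp only [hJ2, hJ]
    rw [← integral_const_mul]
    refine setIntegral_congr_fun measurableSet_Ioi fun x _ => ?_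
    ring
  have hcJ : c * J = 1 := by
    have := toSphere_real_univ_mul_integral_profile volume hrad he₀ hφ.2.2.2.2
    rwa [finrank_euclideanSpace] at this
  -- Step D: solve the linear system
  have hn0 : (n : ℝ) ≠ 0 := by exact_mod_cast (by omega : n ≠ 0)
  have hnge : (2 : ℝ) ≤ n := by exact_mod_cast hn2
  have hn1 : (n : ℝ) - 1 ≠ 0 := by linarith
  have hn2' : (n : ℝ) + 2 ≠ 0 := by linarith
  rw [hJ1eq, hJ2eq] at hDL hDT
  have eL : D ψ = (n : ℝ) / 4 * (-(n : ℝ) * SL ψ + 2 * ST ψ) := by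
    rw [hDL, eyinkLongitudinalConst, ← hndef]
    calc (n : ℝ) / 4 * c * (-(n : ℝ) * J * SL ψ + 2 * J * ST ψ)
        = (n : ℝ) / 4 * (c * J) * (-(n : ℝ) * SL ψ + 2 * ST ψ) := by ring
      _ = _ := by rw [hcJ, mul_one]
  have eT : D ψ = (n : ℝ) / (4 * ((n : ℝ) - 1)) * (-((n : ℝ) + 2) * ST ψ) := by
    rw [hDT, eyinkTransverseConst, ← hndef]
    calc (n : ℝ) / (4 * ((n : ℝ) - 1)) * c * (-(n : ℝ) * J * ST ψ - 2 * J * ST ψ)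
        = (n : ℝ) / (4 * ((n : ℝ) - 1)) * (c * J) * (-((n : ℝ) + 2) * ST ψ) := by ring
      _ = _ := by rw [hcJ, mul_one]
  have hST' : ST ψ = -(4 * ((n : ℝ) - 1) / (n * ((n : ℝ) + 2))) * D ψ := by
    rw [eT]
    field_simp
  have hSL' : SL ψ = -fourFifthsConst d * D ψ := by
    have h1 : SL ψ = (2 * ST ψ - 4 / n * D ψ) / n := by
      rw [eL]
      field_simp
      ring
    rw [fourFifthsConst, ← hndef, h1, hST']
    field_simp
    ring
  exact ⟨hSL', hST'⟩

end CorollaryOne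

/-! ## The printed statements in `d = 3`, as theorems -/

section DimThreeTheorems

-- the three-dimensional flat torus `T³` and velocity space `ℝ³`
local notation "𝕋³" => UnitAddTorus (Fin 3)
local notation "E³" => EuclideanSpace ℝ (Fin 3)

/-- **The Duchon–Robert 4/3 law, conditional form as printed** (Eyink 2003, §1, (1.5)–(1.7),
restating Duchon–Robert 2000, §5): for `u ∈ L³([0,T] × T³)` a weak Euler solution with defect
`D(u)`, *assuming that the limit* `S(u) = 𝒟-lim_{ℓ→0} S(u,ℓ)` of
`S(u,ℓ) = ℓ⁻¹ ⨍_{S²} δu_L(ℓω) |δu(ℓω)|² dω` *exists*, `S(u) = −(4/3) D(u)`. A theorem: the special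
case `d = 3` of `HasDuchonRobertDefect.eq_of_tendsto_energyFlux` (`DuchonRobertShellLaw`; only
the joint measurability in `IsWeakEulerSolutionOn` is used, not the Euler equation).
**Discrepancy record:** the accepted fact `HasDuchonRobertDefect.hasFourThirdsLaw` asserts the
existence of this limit; the source assumes it. [cite: Eyink2003, §1 (1.5)–(1.7)] -/
theorem HasDuchonRobertDefect.fourThirdsLaw_of_limit {T : ℝ} {u : ℝ → 𝕋³ → E³}
    {D S : STFunctional (Fin 3)} (h : HasDuchonRobertDefect T u D) (hE : FunctionSpaces.Torus.IsWeakEulerSolutionOn T u)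
    (hu3 : ∫⁻ t in Ioo 0 T, ∫⁻ x, ‖u t x‖ₑ ^ (3 : ℕ) < ∞)
    (hS : ∀ ψ : ℝ → 𝕋³ → ℝ, FunctionSpaces.Torus.IsSpaceTimeTestIoo T ψ →
      Tendsto (fun ℓ => ∫ t in Ioo 0 T, ∫ x, ℓ⁻¹ * energyFluxSphereAvg (u t) ℓ x * ψ t x)
        (𝓝[>] 0) (𝓝 (S ψ)))
    {ψ : ℝ → 𝕋³ → ℝ} (hψ : FunctionSpaces.Torus.IsSpaceTimeTestIoo T ψ) :
    S ψ = -(4 / 3) * D ψ := by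
  rw [h.eq_of_tendsto_energyFlux hE.1 hu3 hψ (hS ψ hψ), fourThirdsConst_fin_three]

/-- Under the hypothesis of the conditional 4/3 law the accepted predicate
`Torus.HasFourThirdsLaw T u D` holds (`d = 3` case of
`HasDuchonRobertDefect.hasFourThirdsLaw_of_tendsto`). [cite: Eyink2003, §1 (1.5)–(1.7)] -/
theorem HasDuchonRobertDefect.hasFourThirdsLaw_of_limit {T : ℝ} {u : ℝ → 𝕋³ → E³}
    {D S : STFunctional (Fin 3)} (h : HasDuchonRobertDefect T u D) (hE : FunctionSpaces.Torus.IsWeakEulerSolutionOn T u)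
    (hu3 : ∫⁻ t in Ioo 0 T, ∫⁻ x, ‖u t x‖ₑ ^ (3 : ℕ) < ∞)
    (hS : ∀ ψ : ℝ → 𝕋³ → ℝ, FunctionSpaces.Torus.IsSpaceTimeTestIoo T ψ →
      Tendsto (fun ℓ => ∫ t in Ioo 0 T, ∫ x, ℓ⁻¹ * energyFluxSphereAvg (u t) ℓ x * ψ t x)
        (𝓝[>] 0) (𝓝 (S ψ))) :
    HasFourThirdsLaw T u D :=
  h.hasFourThirdsLaw_of_tendsto hE.1 hu3 hS

/-- **Eyink 2003, Corollary 1 (the local 4/5- and 8/15-laws, conditional form as printed).** Let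
`u ∈ L³([0,T] × T³)` be a weak Euler solution with Duchon–Robert defect `D`. *Assume* that
`S_L(u,ℓ) = ℓ⁻¹ ⨍_{S²} (δu_L(ℓω))³ dω` and `S_T(u,ℓ) = ℓ⁻¹ ⨍_{S²} δu_L |δu_T|²(ℓω) dω` have
limits `S_L(u) = 𝒟-lim_{ℓ→0} S_L(u,ℓ)`, `S_T(u) = 𝒟-lim_{ℓ→0} S_T(u,ℓ)` (functionals `SL`, `ST`
with `∫₀ᵀ∫ S_X(u,ℓ) ψ → S_X ψ` as `ℓ → 0⁺` for every test function `ψ` supported in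
`(0,T) × T³`). *Then* `S_L(u) = −(4/5) D(u)` and `S_T(u) = −(8/15) D(u)`.
Proved from Theorem 1, threaded as the hypothesis `hThm : HasDuchonRobertDefect.eyinkApprox_tendsto`
(the only unproved input), exactly as in the source: `eq_of_tendsto_eyinkApprox` with a radial
mollifier supported in the unit ball (`exists_isMollifier_radial`).
**Discrepancy record:** the accepted `HasDuchonRobertDefect.hasFourFifthsLaw` (same cite) and
`Turb.eyink_local_four_fifths` assert the existence of the limit `S_L(u)` for every `L³` weak
Euler solution; the source assumes it. [cite: Eyink2003, §2 Cor. 1] -/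
theorem HasDuchonRobertDefect.fourFifthsLaw_of_limits (hThm : HasDuchonRobertDefect.eyinkApprox_tendsto)
    {T : ℝ} {u : ℝ → 𝕋³ → E³} {D SL ST : STFunctional (Fin 3)} (h : HasDuchonRobertDefect T u D)
    (hE : FunctionSpaces.Torus.IsWeakEulerSolutionOn T u) (hu3 : ∫⁻ t in Ioo 0 T, ∫⁻ x, ‖u t x‖ₑ ^ (3 : ℕ) < ∞)
    (hSL : ∀ ψ : ℝ → 𝕋³ → ℝ, FunctionSpaces.Torus.IsSpaceTimeTestIoo T ψ →
      Tendsto (fun ℓ => ∫ t in Ioo 0 T, ∫ x, ℓ⁻¹ * longitudinalFluxSphereAvg (u t) ℓ x * ψ t x)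
        (𝓝[>] 0) (𝓝 (SL ψ)))
    (hST : ∀ ψ : ℝ → 𝕋³ → ℝ, FunctionSpaces.Torus.IsSpaceTimeTestIoo T ψ →
      Tendsto (fun ℓ => ∫ t in Ioo 0 T, ∫ x, ℓ⁻¹ * mixedFluxSphereAvg (u t) ℓ x * ψ t x)
        (𝓝[>] 0) (𝓝 (ST ψ)))
    {ψ : ℝ → 𝕋³ → ℝ} (hψ : FunctionSpaces.Torus.IsSpaceTimeTestIoo T ψ) :
    SL ψ = -(4 / 5) * D ψ ∧ ST ψ = -(8 / 15) * D ψ := by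
  obtain ⟨φ, hφ, hrad, hφsupp⟩ := exists_isMollifier_radial (d := Fin 3)
  have hlim := hThm h hE hu3 hφ hrad hψ
  have h3 : 2 ≤ Fintype.card (Fin 3) := by simp
  have := eq_of_tendsto_eyinkApprox h3 hφ hrad hφsupp hE.1 hu3 hψ hlim.1 hlim.2 (hSL ψ hψ)
    (hST ψ hψ)
  refine ⟨?_, ?_⟩
  · rw [this.1, fourFifthsConst_fin_three]
  · rw [this.2]
    norm_num [Fintype.card_fin]

/-- Under the hypotheses of Cor. 1 (and Thm. 1 as the threaded fact) the accepted predicate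
`Torus.HasFourFifthsLaw T u D` holds: the assumed limit `S_L` is identified as
`−(4/5) D = −fourFifthsConst (Fin 3) · D` (`fourFifthsConst_fin_three`). This is how the
corrected statement feeds the consumers of `HasDuchonRobertDefect.hasFourFifthsLaw`. [cite: Eyink2003, §2 Cor. 1] -/
theorem HasDuchonRobertDefect.hasFourFifthsLaw_of_limits
    (hThm : HasDuchonRobertDefect.eyinkApprox_tendsto)
    {T : ℝ} {u : ℝ → 𝕋³ → E³} {D SL ST : STFunctional (Fin 3)} (h : HasDuchonRobertDefect T u D)
    (hE : FunctionSpaces.Torus.IsWeakEulerSolutionOn T u) (hu3 : ∫⁻ t in Ioo 0 T, ∫⁻ x, ‖u t x‖ₑ ^ (3 : ℕ) < ∞)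
    (hSL : ∀ ψ : ℝ → 𝕋³ → ℝ, FunctionSpaces.Torus.IsSpaceTimeTestIoo T ψ →
      Tendsto (fun ℓ => ∫ t in Ioo 0 T, ∫ x, ℓ⁻¹ * longitudinalFluxSphereAvg (u t) ℓ x * ψ t x)
        (𝓝[>] 0) (𝓝 (SL ψ)))
    (hST : ∀ ψ : ℝ → 𝕋³ → ℝ, FunctionSpaces.Torus.IsSpaceTimeTestIoo T ψ →
      Tendsto (fun ℓ => ∫ t in Ioo 0 T, ∫ x, ℓ⁻¹ * mixedFluxSphereAvg (u t) ℓ x * ψ t x)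
        (𝓝[>] 0) (𝓝 (ST ψ))) :
    HasFourFifthsLaw T u D := by
  intro ψ hψ
  have hlim := hSL ψ hψ
  rwa [(h.fourFifthsLaw_of_limits hThm hE hu3 hSL hST hψ).1, ← fourFifthsConst_fin_three] at hlim

/-- Under the hypotheses of Cor. 1 the assumed limit `S_T` satisfies the **8/15 law**
`∫₀ᵀ∫ ℓ⁻¹ ⟨δu_L |δu_T|²⟩_{ang} ψ → −(8/15) D ψ` (Eyink 2003, Cor. 1; halving `|δu_T|²` to one
transverse component gives the conventional 4/15 law). [cite: Eyink2003, §2 Cor. 1] -/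
theorem HasDuchonRobertDefect.tendsto_mixedFlux_of_limits
    (hThm : HasDuchonRobertDefect.eyinkApprox_tendsto)
    {T : ℝ} {u : ℝ → 𝕋³ → E³} {D SL ST : STFunctional (Fin 3)} (h : HasDuchonRobertDefect T u D)
    (hE : FunctionSpaces.Torus.IsWeakEulerSolutionOn T u) (hu3 : ∫⁻ t in Ioo 0 T, ∫⁻ x, ‖u t x‖ₑ ^ (3 : ℕ) < ∞)
    (hSL : ∀ ψ : ℝ → 𝕋³ → ℝ, FunctionSpaces.Torus.IsSpaceTimeTestIoo T ψ →
      Tendsto (fun ℓ => ∫ t in Ioo 0 T, ∫ x, ℓ⁻¹ * longitudinalFluxSphereAvg (u t) ℓ x * ψ t x)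
        (𝓝[>] 0) (𝓝 (SL ψ)))
    (hST : ∀ ψ : ℝ → 𝕋³ → ℝ, FunctionSpaces.Torus.IsSpaceTimeTestIoo T ψ →
      Tendsto (fun ℓ => ∫ t in Ioo 0 T, ∫ x, ℓ⁻¹ * mixedFluxSphereAvg (u t) ℓ x * ψ t x)
        (𝓝[>] 0) (𝓝 (ST ψ)))
    {ψ : ℝ → 𝕋³ → ℝ} (hψ : FunctionSpaces.Torus.IsSpaceTimeTestIoo T ψ) :
    Tendsto (fun ℓ => ∫ t in Ioo 0 T, ∫ x, ℓ⁻¹ * mixedFluxSphereAvg (u t) ℓ x * ψ t x)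
      (𝓝[>] 0) (𝓝 (-(8 / 15) * D ψ)) := by
  have hlim := hST ψ hψ
  rwa [(h.fourFifthsLaw_of_limits hThm hE hu3 hSL hST hψ).2] at hlim

/-- Conversely, the (stronger, unconditional) accepted fact `HasDuchonRobertDefect.hasFourFifthsLaw`
implies the longitudinal identification: if the 4/5 law holds with limit `−(4/5) D`, any assumed
limit `S_L` equals `−(4/5) D` (uniqueness of limits along `𝓝[>] 0`). [folklore] -/
theorem HasFourFifthsLaw.eq_of_tendsto {T : ℝ} {u : ℝ → 𝕋³ → E³} {D SL : STFunctional (Fin 3)}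
    (h45 : HasFourFifthsLaw T u D)
    (hSL : ∀ ψ : ℝ → 𝕋³ → ℝ, FunctionSpaces.Torus.IsSpaceTimeTestIoo T ψ →
      Tendsto (fun ℓ => ∫ t in Ioo 0 T, ∫ x, ℓ⁻¹ * longitudinalFluxSphereAvg (u t) ℓ x * ψ t x)
        (𝓝[>] 0) (𝓝 (SL ψ)))
    {ψ : ℝ → 𝕋³ → ℝ} (hψ : FunctionSpaces.Torus.IsSpaceTimeTestIoo T ψ) :
    SL ψ = -(4 / 5) * D ψ := by
  have := tendsto_nhds_unique (hSL ψ hψ) (h45 ψ hψ)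
  rw [this, fourFifthsConst_fin_three]

end DimThreeTheorems

end Literature.Analysis.FluidPDE.Torus
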